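/-
Copyright: statement-level skeleton of a published paper (lit-balaban cell, Phase-2 proof seat p13, gen 9). No proof
claims beyond what the kernel checks below.
-/
import Literature.MathematicalPhysics.QuantumFieldTheory.BalabanImbrieJaffe1984to88.BIJ88Expansion577

/-!
# `BalabanImbrieJaffe1984to88.BIJ88Expansion577Bounds` — T. Bałaban, J. Imbrie, A. Jaffe, *Effective action and cluster
properties of the abelian Higgs model*, Commun. Math. Phys. **114** (1988) 257–315 [BalabanImbrieJaffe1988]: Sect. 5.7,
p. 290, **(5.7.7)**, the SIZE clause: *"Both terms involve small, bounded kernels (of order e_j^{1−α} for V^{(n̄)}, of order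
e_j^{n̄+1−α}e^{−cr(e_k)|X|⁻} for V(X)), alone or applied to D_{u_{k+1}} or D*_{u_{k+1}}."* — the bounds of the two parts of the
expansions of `BIJ88Expansion577` under sums and products, and the printed shape for `V_j(X)` (file 2b of seat p13 gen 9;
2a = `BIJ88Expansion577` proves the identity (5.7.7)).  The order-`≤ n̄` part is measured with a WEIGHT `ρ ∈ [|e_j|, 1]`
(`lowNormW ρ = Σ_n ρⁿ‖low n‖`; `ρ = 1` is 2a's `lowNorm`): the overflow orders then carry the factor `(|e_j|/ρ)^{n̄+1}`, and with
`ρ` small the order-`≥ 1` expansions are small in norm (used by file 3 for the Neumann series of p. 290).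

statement-level skeleton of published theorems with citation tags; proofs where landed; nothing here is a claim about the Yang–Mills mass gap

PDF held: `paper:balaban1988-cmp114-bij-abelian-higgs-effective-action` (journal page = PDF page + 256); pp. 287–290
[PDF 31–34] read as IMAGES (CCITT renders; copies `HOME/lit-balaban-p13/pages/`).

CITATION HEADER (lean-in-tree rule).  Part of the lit-balaban TYPED SKELETON (HOME `run/shared/lean/pub/lit-balaban/`):
WHAT IS REPRODUCED = row **C2.Eq5.7.7-5.7.9** of `HOME/lit-balaban-r16/ROWS-C2-part2.md`, member **(5.7.7)**, size clause.
Unit `lit-balaban-p13` (gen 9), owner r16, referee ref-5.  Built BY NAME on file 2a (`GLExp`, `lowVal`, `mul`, `conv`,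
`overflow`, `pairAct`, `lsum`, `lowNorm`, `actNorm`, `Rooted`, `vertexExp`, …), gen 8's `BIJ88TraceTerms579.cubePolymers`
and r16's `PolymerSys.cardMinus`; nothing restated.

## What is kernel-checked here

* §1 the order-`≤ n̄` part: `lowNormW` (weight `ρ`; `lowNormW_one_weight` = 2a's `lowNorm`), `norm_lowVal_le` (`‖Σ_n e_jⁿ low n‖ ≤
  lowNormW ρ`, `|e_j| ≤ ρ`), `norm_lowVal_le_mul` (positive order ⇒ an extra `|e_j|/ρ`: *"small (O(e_j^{1−α}))"*),
  `norm_overflow_le` (`≤ (|e_j|/ρ)^{n̄+1}lowNormW E·lowNormW F`), **`lowNormW_mul_le`** (`≤ lowNormW E·lowNormW F`).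
* §2 the localized part: `norm_act_le_actNorm` (POINTWISE `‖act X‖ ≤ actNorm κ·e^{−κ|X|⁻}`), `cardMinus_union_le` (`|Y ∪ Z|⁻ ≤
  |Y|⁻ + |Z|⁻` through a common cube), **`actNorm_mul_le`** (`actNorm κ (E·F) ≤ (|e_j|/ρ)^{n̄+1}lowNormW E lowNormW F + lowNormW E·
  actNorm F + actNorm E·lowNormW F + actNorm E·actNorm F` for rooted factors — the rate `κ = cr(e_k)` is NOT degraded).
* §3 linear combinations: `lowNormW_lsum_le`, `actNorm_lsum_le`.
* §4 `V_j`: **`lowNormW_vertexExp_le`**, **`norm_vertexLow_le`** (*"of order e_j^{1−α} for V^{(n̄)}"*: `‖V_j^{(n̄)}‖ ≤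
  (|e_j|/ρ)·Σ_k‖c_k‖L_kL′_k`), **`actNorm_vertexExp_le`**, `norm_vertexAct_le`, and the PRINTED SHAPE **`norm_vertexAct_le_printed`**
  (`‖V_j(X)‖ ≤ e_j^{n̄+1−α′}e^{−κ|X|⁻}` under uniform factor bounds `lowNormW ρ ≤ L`, `actNorm κ ≤ δ` and the displayed constants
  inequality `(Σ_k‖c_k‖)((e_j/ρ)^{n̄+1}L² + 2Lδ + δ²) ≤ e_j^{n̄+1−α′}` — generic-constant reading, G-C2-p36-03).

HONEST SCOPE as in file 2a (model level: kernel entries; coefficients, factor expansions and their norms are inputs — file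
1a/1b give them for `F_{1,j}`, `F_{2,j}`).  Theorems only; no `Prop` facts; axioms standard.
-/

noncomputable section

open scoped BigOperators
open Finset

namespace Literature.MathematicalPhysics.QuantumFieldTheory.BalabanImbrieJaffe1984to88.BIJ88Expansion577Bounds

open BIJ88TraceTerms579 (cubePolymers)
open BIJ88Sect5StatementsPart2 (PolymerSys)
open BIJ88Expansion577 BIJ88Expansion577.GLExp

variable {ι : Type}

/-! ## §1 The order-`≤ n̄` part, with a weight `ρ ∈ [|e_j|, 1]` -/

/-- the weighted size of the order-`≤ n̄` part: `Σ_{n ≤ n̄} ρⁿ‖low n‖` (`ρ = 1`: 2a's `lowNorm`; `ρ ≥ |e_j|`).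
[cite: BalabanImbrieJaffe1988, (5.7.7) p.290] -/
def lowNormW (ρ : ℝ) (nbar : ℕ) (E : GLExp ι) : ℝ := ∑ n ∈ range (nbar + 1), ρ ^ n * ‖E.low n‖

section LowBounds

variable (ρ : ℝ) (nbar : ℕ)

/-- weight `1` gives 2a's `lowNorm`. [cite: BalabanImbrieJaffe1988, (5.7.7) p.290] -/
theorem lowNormW_one_weight (E : GLExp ι) : lowNormW 1 nbar E = E.lowNorm nbar := by
  simp [lowNormW, lowNorm]

/-- [cite: BalabanImbrieJaffe1988, (5.7.7) p.290] -/
theorem lowNormW_nonneg {ρ : ℝ} (hρ : 0 ≤ ρ) (E : GLExp ι) : 0 ≤ lowNormW ρ nbar E :=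
  Finset.sum_nonneg fun _ _ => mul_nonneg (pow_nonneg hρ _) (norm_nonneg _)

/-- the order-`≤ n̄` part is bounded by `lowNormW ρ` for `|e_j| ≤ ρ`. [cite: BalabanImbrieJaffe1988, (5.7.7) p.290] -/
theorem norm_lowVal_le {ρ ε : ℝ} (hερ : |ε| ≤ ρ) (E : GLExp ι) : ‖E.lowVal nbar ε‖ ≤ lowNormW ρ nbar E := by
  unfold lowVal lowNormW
  refine (norm_sum_le _ _).trans (Finset.sum_le_sum fun n _ => ?_)
  rw [norm_mul, norm_pow, Complex.norm_real, Real.norm_eq_abs]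
  exact mul_le_mul_of_nonneg_right (pow_le_pow_left₀ (abs_nonneg _) hερ _) (norm_nonneg _)

/-- for an expansion of positive order (`low 0 = 0`: the `F`'s of p. 290 start at `n = 1`), `‖lowVal‖ ≤ (|e_j|/ρ)·lowNormW ρ`
(`|e_j| ≤ ρ`, `ρ > 0`) — *"small (O(e_j^{1−α}))"*. [cite: BalabanImbrieJaffe1988, (5.6.11) p.287, (5.7.7) p.290] -/
theorem norm_lowVal_le_mul {ρ ε : ℝ} (hρ : 0 < ρ) (hερ : |ε| ≤ ρ) {E : GLExp ι} (hE : E.low 0 = 0) :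
    ‖E.lowVal nbar ε‖ ≤ |ε| / ρ * lowNormW ρ nbar E := by
  unfold lowVal lowNormW
  rw [Finset.mul_sum]
  refine (norm_sum_le _ _).trans (Finset.sum_le_sum fun n _ => ?_)
  rcases Nat.eq_zero_or_pos n with rfl | hn
  · rw [hE]; simp
  · rw [norm_mul, norm_pow, Complex.norm_real, Real.norm_eq_abs, ← mul_assoc]
    refine mul_le_mul_of_nonneg_right ?_ (norm_nonneg _)
    have h1 : |ε| / ρ ≤ 1 := (div_le_one hρ).mpr hερ
    calc |ε| ^ n = (|ε| / ρ) ^ n * ρ ^ n := by rw [← mul_pow, div_mul_cancel₀ _ hρ.ne']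
      _ ≤ (|ε| / ρ) ^ 1 * ρ ^ n :=
          mul_le_mul_of_nonneg_right (pow_le_pow_of_le_one (div_nonneg (abs_nonneg _) hρ.le) h1 hn) (pow_nonneg hρ.le _)
      _ = |ε| / ρ * ρ ^ n := by rw [pow_one]

/-- [cite: BalabanImbrieJaffe1988, (5.7.7) p.290] -/
theorem lowNormW_one : lowNormW ρ nbar (one : GLExp ι) = 1 := by
  unfold lowNormW one
  rw [Finset.sum_eq_single 0 (fun n _ hn => by simp [hn]) (fun h => absurd (Finset.mem_range.mpr (Nat.succ_pos _)) h)]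
  simp

/-- norm of the overflow orders: `≤ (|e_j|/ρ)^{n̄+1}·lowNormW E·lowNormW F` for `|e_j| ≤ ρ`, `ρ > 0` (every overflow order is
`≥ n̄+1`). [cite: BalabanImbrieJaffe1988, (5.7.7) p.290] -/
theorem norm_overflow_le {ρ ε : ℝ} (hρ : 0 < ρ) (hερ : |ε| ≤ ρ) (E F : GLExp ι) :
    ‖overflow nbar ε E F‖ ≤ (|ε| / ρ) ^ (nbar + 1) * (lowNormW ρ nbar E * lowNormW ρ nbar F) := by
  have h1 : |ε| / ρ ≤ 1 := (div_le_one hρ).mpr hερ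
  have h0 : 0 ≤ |ε| / ρ := div_nonneg (abs_nonneg _) hρ.le
  unfold overflow lowNormW
  rw [Finset.sum_mul_sum, Finset.mul_sum]
  refine (norm_sum_le _ _).trans (Finset.sum_le_sum fun i _ => ?_)
  rw [Finset.mul_sum]
  refine (norm_sum_le _ _).trans (Finset.sum_le_sum fun j _ => ?_)
  by_cases h : nbar < i + j
  · rw [if_pos h, norm_mul, norm_pow, Complex.norm_real, Real.norm_eq_abs, norm_mul]
    have hsplit : |ε| ^ (i + j) = (|ε| / ρ) ^ (i + j) * (ρ ^ i * ρ ^ j) := by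
      rw [← pow_add, ← mul_pow, div_mul_cancel₀ _ hρ.ne']
    rw [hsplit]
    calc (|ε| / ρ) ^ (i + j) * (ρ ^ i * ρ ^ j) * (‖E.low i‖ * ‖F.low j‖)
        ≤ (|ε| / ρ) ^ (nbar + 1) * (ρ ^ i * ρ ^ j) * (‖E.low i‖ * ‖F.low j‖) := by
          have := pow_le_pow_of_le_one h0 h1 h
          have hρ2 : 0 ≤ ρ ^ i * ρ ^ j := mul_nonneg (pow_nonneg hρ.le _) (pow_nonneg hρ.le _)
          exact mul_le_mul_of_nonneg_right (mul_le_mul_of_nonneg_right this hρ2) (by positivity)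
      _ = (|ε| / ρ) ^ (nbar + 1) * (ρ ^ i * ‖E.low i‖ * (ρ ^ j * ‖F.low j‖)) := by ring
  · rw [if_neg h, norm_zero]
    exact mul_nonneg (pow_nonneg h0 _) (mul_nonneg (mul_nonneg (pow_nonneg hρ.le _) (norm_nonneg _))
      (mul_nonneg (pow_nonneg hρ.le _) (norm_nonneg _)))

/-- the truncated product of the low parts is bounded by the product of the weighted sizes (`ρ ≥ 0`).
[cite: BalabanImbrieJaffe1988, (5.7.7) p.290] -/
theorem lowNormW_mul_le [Fintype ι] [DecidableEq ι] {ρ : ℝ} (hρ : 0 ≤ ρ) (ε : ℝ) (c₀ : ι) (E F : GLExp ι) :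
    lowNormW ρ nbar (mul nbar ε c₀ E F) ≤ lowNormW ρ nbar E * lowNormW ρ nbar F := by
  unfold lowNormW
  calc ∑ n ∈ range (nbar + 1), ρ ^ n * ‖(mul nbar ε c₀ E F).low n‖
      ≤ ∑ n ∈ range (nbar + 1), ∑ i ∈ range (nbar + 1), ∑ j ∈ range (nbar + 1),
          (if i + j = n then ρ ^ n * (‖E.low i‖ * ‖F.low j‖) else 0) := by
        refine Finset.sum_le_sum fun n hn => ?_
        rw [mul_low_of_le nbar ε c₀ (Nat.le_of_lt_succ (Finset.mem_range.mp hn)), conv]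
        refine (mul_le_mul_of_nonneg_left (norm_sum_le _ _) (pow_nonneg hρ _)).trans ?_
        rw [Finset.mul_sum]
        refine Finset.sum_le_sum fun i _ => ?_
        refine (mul_le_mul_of_nonneg_left (norm_sum_le _ _) (pow_nonneg hρ _)).trans ?_
        rw [Finset.mul_sum]
        refine Finset.sum_le_sum fun j _ => ?_
        split_ifs
        · exact mul_le_mul_of_nonneg_left (norm_mul_le _ _) (pow_nonneg hρ _)
        · rw [norm_zero, mul_zero]
    _ = ∑ i ∈ range (nbar + 1), ∑ j ∈ range (nbar + 1),
          (if i + j ≤ nbar then ρ ^ (i + j) * (‖E.low i‖ * ‖F.low j‖) else 0) :=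
        sum_range_delta_eq nbar fun i j n => ρ ^ n * (‖E.low i‖ * ‖F.low j‖)
    _ ≤ ∑ i ∈ range (nbar + 1), ∑ j ∈ range (nbar + 1), ρ ^ (i + j) * (‖E.low i‖ * ‖F.low j‖) := by
        refine Finset.sum_le_sum fun i _ => Finset.sum_le_sum fun j _ => ?_
        split_ifs
        · exact le_rfl
        · exact mul_nonneg (pow_nonneg hρ _) (mul_nonneg (norm_nonneg _) (norm_nonneg _))
    _ = (∑ i ∈ range (nbar + 1), ρ ^ i * ‖E.low i‖) * ∑ j ∈ range (nbar + 1), ρ ^ j * ‖F.low j‖ := by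
        rw [Finset.sum_mul_sum]
        refine Finset.sum_congr rfl fun i _ => Finset.sum_congr rfl fun j _ => ?_
        rw [pow_add]; ring

end LowBounds

/-! ## §2 The localized part -/

section ActBounds

variable [Fintype ι] (nbar : ℕ) (κ : ℝ)

/-- [cite: BalabanImbrieJaffe1988, (5.7.7) p.290] -/
theorem actNorm_nonneg (E : GLExp ι) : 0 ≤ E.actNorm κ :=
  Finset.sum_nonneg fun _ _ => mul_nonneg (norm_nonneg _) (Real.exp_pos _).le

/-- **POINTWISE DECAY from the norm**: `‖act X‖ ≤ actNorm κ · e^{−κ|X|⁻}` — the printed shape *"of order … e^{−cr(e_k)|X|⁻}"*.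
[cite: BalabanImbrieJaffe1988, (5.7.7) p.290] -/
theorem norm_act_le_actNorm (E : GLExp ι) (X : Finset ι) :
    ‖E.act X‖ ≤ E.actNorm κ * Real.exp (-κ * (cubePolymers ι).cardMinus X) := by
  have h : ‖E.act X‖ * Real.exp (κ * (cubePolymers ι).cardMinus X) ≤ E.actNorm κ :=
    Finset.single_le_sum (f := fun X => ‖E.act X‖ * Real.exp (κ * (cubePolymers ι).cardMinus X))
      (fun _ _ => mul_nonneg (norm_nonneg _) (Real.exp_pos _).le) (Finset.mem_univ X)
  calc ‖E.act X‖ = ‖E.act X‖ * Real.exp (κ * (cubePolymers ι).cardMinus X) *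
        Real.exp (-κ * (cubePolymers ι).cardMinus X) := by
        rw [mul_assoc, ← Real.exp_add, neg_mul, add_neg_cancel, Real.exp_zero, mul_one]
    _ ≤ E.actNorm κ * Real.exp (-κ * (cubePolymers ι).cardMinus X) := mul_le_mul_of_nonneg_right h (Real.exp_pos _).le

/-- [cite: BalabanImbrieJaffe1988, (5.7.7) p.290] -/
theorem actNorm_one : (one : GLExp ι).actNorm κ = 0 := by
  simp [actNorm, one]

omit [Fintype ι] in
/-- regions through a common cube: `|Y ∪ Z|⁻ ≤ |Y|⁻ + |Z|⁻` — why the decay rate survives products.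
[cite: BalabanImbrieJaffe1988, (5.7.7) p.290] -/
theorem cardMinus_union_le [DecidableEq ι] {Y Z : Finset ι} {c : ι} (hY : c ∈ Y) (hZ : c ∈ Z) :
    (cubePolymers ι).cardMinus (Y ∪ Z : Finset ι) ≤ (cubePolymers ι).cardMinus Y + (cubePolymers ι).cardMinus Z := by
  show (Y ∪ Z).card - 1 ≤ (Y.card - 1) + (Z.card - 1)
  have h1 : (Y ∪ Z).card + (Y ∩ Z).card = Y.card + Z.card := Finset.card_union_add_card_inter Y Z
  have h2 : 1 ≤ (Y ∩ Z).card := Finset.card_pos.mpr ⟨c, Finset.mem_inter.mpr ⟨hY, hZ⟩⟩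
  have h3 : 1 ≤ Y.card := Finset.card_pos.mpr ⟨c, hY⟩
  have h4 : 1 ≤ Z.card := Finset.card_pos.mpr ⟨c, hZ⟩
  omega

/-- **THE LOCALIZED PART OF A PRODUCT**: for rooted factors, `0 < ρ`, `|e_j| ≤ ρ`, `κ ≥ 0`:
`actNorm κ (E·F) ≤ (|e_j|/ρ)^{n̄+1}lowNormW E·lowNormW F + lowNormW E·actNorm κ F + actNorm κ E·lowNormW F + actNorm κ E·actNorm κ F`
— *"of order e_j^{n̄+1−α}e^{−cr(e_k)|X|⁻} for V(X)"* with the SAME rate `κ`. [cite: BalabanImbrieJaffe1988, (5.7.7) p.290] -/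
theorem actNorm_mul_le [DecidableEq ι] {ρ ε : ℝ} (c₀ : ι) (hρ : 0 < ρ) (hερ : |ε| ≤ ρ) (hκ : 0 ≤ κ) {E F : GLExp ι}
    (hE : Rooted c₀ E) (hF : Rooted c₀ F) :
    (mul nbar ε c₀ E F).actNorm κ ≤
      (|ε| / ρ) ^ (nbar + 1) * (lowNormW ρ nbar E * lowNormW ρ nbar F) + lowNormW ρ nbar E * F.actNorm κ +
        E.actNorm κ * lowNormW ρ nbar F + E.actNorm κ * F.actNorm κ := by
  set P := cubePolymers ι with hP
  have hw : ∀ X : Finset ι, 0 ≤ Real.exp (κ * P.cardMinus X) := fun X => (Real.exp_pos _).le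
  -- split the four contributions termwise
  have hsplit : (mul nbar ε c₀ E F).actNorm κ ≤
      (∑ X : Finset ι, ‖(if X = {c₀} then overflow nbar ε E F else 0)‖ * Real.exp (κ * P.cardMinus X)) +
      (∑ X : Finset ι, ‖E.lowVal nbar ε * F.act X‖ * Real.exp (κ * P.cardMinus X)) +
      (∑ X : Finset ι, ‖E.act X * F.lowVal nbar ε‖ * Real.exp (κ * P.cardMinus X)) +
      ∑ X : Finset ι, ‖E.pairAct F X‖ * Real.exp (κ * P.cardMinus X) := by
    unfold actNorm
    rw [← Finset.sum_add_distrib, ← Finset.sum_add_distrib, ← Finset.sum_add_distrib]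
    refine Finset.sum_le_sum fun X _ => ?_
    rw [← add_mul, ← add_mul, ← add_mul]
    refine mul_le_mul_of_nonneg_right ?_ (hw X)
    exact (norm_add_le _ _).trans (add_le_add ((norm_add_le _ _).trans (add_le_add (norm_add_le _ _) le_rfl)) le_rfl)
  refine hsplit.trans (add_le_add (add_le_add (add_le_add ?_ ?_) ?_) ?_)
  · -- overflow on the home cube: |{c₀}|⁻ = 0
    rw [Finset.sum_eq_single ({c₀} : Finset ι) (fun X _ hX => by rw [if_neg hX, norm_zero, zero_mul])
      (fun h => absurd (Finset.mem_univ _) h), if_pos rfl]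
    have h0 : P.cardMinus ({c₀} : Finset ι) = 0 := by
      show ({c₀} : Finset ι).card - 1 = 0; simp
    rw [h0, Nat.cast_zero, mul_zero, Real.exp_zero, mul_one]
    exact norm_overflow_le nbar hρ hερ E F
  · -- low × localized
    unfold actNorm
    rw [Finset.mul_sum]
    refine Finset.sum_le_sum fun X _ => ?_
    rw [norm_mul, mul_assoc]
    exact mul_le_mul_of_nonneg_right (norm_lowVal_le nbar hερ E) (mul_nonneg (norm_nonneg _) (hw X))
  · -- localized × low
    unfold actNorm
    rw [Finset.sum_mul]
    refine Finset.sum_le_sum fun X _ => ?_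
    rw [norm_mul, mul_right_comm]
    exact mul_le_mul_of_nonneg_left (norm_lowVal_le nbar hερ F) (mul_nonneg (norm_nonneg _) (hw X))
  · -- localized × localized, regrouped on the union; the rate survives by `cardMinus_union_le`
    unfold actNorm
    calc ∑ X : Finset ι, ‖E.pairAct F X‖ * Real.exp (κ * P.cardMinus X)
        ≤ ∑ X : Finset ι, ∑ p ∈ ((univ : Finset (Finset ι)) ×ˢ univ).filter (fun p => p.1 ∪ p.2 = X),
            ‖E.act p.1‖ * Real.exp (κ * P.cardMinus p.1) * (‖F.act p.2‖ * Real.exp (κ * P.cardMinus p.2)) := by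
          refine Finset.sum_le_sum fun X _ => ?_
          unfold pairAct
          refine (mul_le_mul_of_nonneg_right (norm_sum_le _ _) (hw X)).trans ?_
          rw [Finset.sum_mul]
          refine Finset.sum_le_sum fun p hp => ?_
          have hpX : p.1 ∪ p.2 = X := (Finset.mem_filter.mp hp).2
          rw [norm_mul]
          by_cases hz : E.act p.1 = 0 ∨ F.act p.2 = 0
          · rcases hz with hz | hz
            · rw [hz, norm_zero, zero_mul, zero_mul, zero_mul, zero_mul]
            · rw [hz, norm_zero, mul_zero, zero_mul, zero_mul, mul_zero]
          · push Not at hz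
            have hc : P.cardMinus X ≤ P.cardMinus p.1 + P.cardMinus p.2 :=
              hpX ▸ cardMinus_union_le (hE _ hz.1) (hF _ hz.2)
            have hexp : Real.exp (κ * P.cardMinus X) ≤
                Real.exp (κ * P.cardMinus p.1) * Real.exp (κ * P.cardMinus p.2) := by
              rw [← Real.exp_add, Real.exp_le_exp, ← mul_add]
              exact mul_le_mul_of_nonneg_left (by exact_mod_cast hc) hκ
            calc ‖E.act p.1‖ * ‖F.act p.2‖ * Real.exp (κ * P.cardMinus X)
                ≤ ‖E.act p.1‖ * ‖F.act p.2‖ * (Real.exp (κ * P.cardMinus p.1) * Real.exp (κ * P.cardMinus p.2)) :=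
                  mul_le_mul_of_nonneg_left hexp (mul_nonneg (norm_nonneg _) (norm_nonneg _))
              _ = _ := by ring
      _ = ∑ p ∈ (univ : Finset (Finset ι)) ×ˢ univ,
            ‖E.act p.1‖ * Real.exp (κ * P.cardMinus p.1) * (‖F.act p.2‖ * Real.exp (κ * P.cardMinus p.2)) :=
          Finset.sum_fiberwise_of_maps_to (g := fun p : Finset ι × Finset ι => p.1 ∪ p.2) (fun _ _ => Finset.mem_univ _) _
      _ = (∑ Y : Finset ι, ‖E.act Y‖ * Real.exp (κ * P.cardMinus Y)) *
            ∑ Z : Finset ι, ‖F.act Z‖ * Real.exp (κ * P.cardMinus Z) := by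
          rw [Finset.sum_product, Finset.sum_mul_sum]

/-- the TOTAL SIZE `lowNormW + actNorm` is sub-multiplicative up to a factor `2` (rooted factors, `0 < ρ`, `|e_j| ≤ ρ`, `κ ≥ 0`)
— the form used for the Neumann series of p. 290. [cite: BalabanImbrieJaffe1988, (5.7.7) p.290] -/
theorem size_mul_le [DecidableEq ι] {ρ ε : ℝ} (c₀ : ι) (hρ : 0 < ρ) (hερ : |ε| ≤ ρ) (hκ : 0 ≤ κ) {E F : GLExp ι}
    (hE : Rooted c₀ E) (hF : Rooted c₀ F) :
    lowNormW ρ nbar (mul nbar ε c₀ E F) + (mul nbar ε c₀ E F).actNorm κ ≤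
      2 * ((lowNormW ρ nbar E + E.actNorm κ) * (lowNormW ρ nbar F + F.actNorm κ)) := by
  have h1 := lowNormW_mul_le nbar hρ.le ε c₀ E F
  have h2 := actNorm_mul_le nbar κ c₀ hρ hερ hκ hE hF
  have hq : (|ε| / ρ) ^ (nbar + 1) ≤ 1 := pow_le_one₀ (div_nonneg (abs_nonneg _) hρ.le) ((div_le_one hρ).mpr hερ)
  have a0 := lowNormW_nonneg nbar hρ.le E
  have b0 := lowNormW_nonneg nbar hρ.le F
  have c0 := actNorm_nonneg κ E
  have d0 := actNorm_nonneg κ F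
  have hq' : (|ε| / ρ) ^ (nbar + 1) * (lowNormW ρ nbar E * lowNormW ρ nbar F) ≤ lowNormW ρ nbar E * lowNormW ρ nbar F :=
    (mul_le_mul_of_nonneg_right hq (mul_nonneg a0 b0)).trans (by rw [one_mul])
  nlinarith [mul_nonneg a0 d0, mul_nonneg c0 b0, mul_nonneg c0 d0, mul_nonneg a0 b0]

end ActBounds

/-! ## §3 Linear combinations -/

section LSum

variable {K : Type*} (nbar : ℕ)

/-- [cite: BalabanImbrieJaffe1988, (5.7.7) p.290] -/
theorem lowNormW_lsum_le {ρ : ℝ} (hρ : 0 ≤ ρ) (s : Finset K) (c : K → ℂ) (E : K → GLExp ι) :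
    lowNormW ρ nbar (lsum s c E) ≤ ∑ k ∈ s, ‖c k‖ * lowNormW ρ nbar (E k) := by
  unfold lowNormW lsum
  simp only [Finset.mul_sum]
  rw [Finset.sum_comm]
  refine Finset.sum_le_sum fun n _ => ?_
  refine (mul_le_mul_of_nonneg_left (norm_sum_le _ _) (pow_nonneg hρ _)).trans ?_
  rw [Finset.mul_sum]
  refine Finset.sum_le_sum fun k _ => ?_
  rw [norm_mul]; ring_nf; exact le_rfl

/-- [cite: BalabanImbrieJaffe1988, (5.7.7) p.290] -/
theorem actNorm_lsum_le [Fintype ι] (κ : ℝ) (s : Finset K) (c : K → ℂ) (E : K → GLExp ι) :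
    (lsum s c E).actNorm κ ≤ ∑ k ∈ s, ‖c k‖ * (E k).actNorm κ := by
  unfold actNorm lsum
  simp only [Finset.mul_sum]
  rw [Finset.sum_comm]
  refine Finset.sum_le_sum fun X _ => ?_
  calc ‖∑ k ∈ s, c k * (E k).act X‖ * Real.exp (κ * (cubePolymers ι).cardMinus X)
      ≤ (∑ k ∈ s, ‖c k * (E k).act X‖) * Real.exp (κ * (cubePolymers ι).cardMinus X) :=
        mul_le_mul_of_nonneg_right (norm_sum_le _ _) (Real.exp_pos _).le
    _ = ∑ k ∈ s, ‖c k‖ * (‖(E k).act X‖ * Real.exp (κ * (cubePolymers ι).cardMinus X)) := by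
        rw [Finset.sum_mul]
        exact Finset.sum_congr rfl fun k _ => by rw [norm_mul, mul_assoc]

/-- the total size of a linear combination. [cite: BalabanImbrieJaffe1988, (5.7.7) p.290] -/
theorem size_lsum_le [Fintype ι] {ρ : ℝ} (hρ : 0 ≤ ρ) (κ : ℝ) (s : Finset K) (c : K → ℂ) (E : K → GLExp ι) :
    lowNormW ρ nbar (lsum s c E) + (lsum s c E).actNorm κ ≤ ∑ k ∈ s, ‖c k‖ * (lowNormW ρ nbar (E k) + (E k).actNorm κ) := by
  refine (add_le_add (lowNormW_lsum_le nbar hρ s c E) (actNorm_lsum_le κ s c E)).trans (le_of_eq ?_)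
  rw [← Finset.sum_add_distrib]
  exact Finset.sum_congr rfl fun k _ => by ring

end LSum

/-! ## §4 The two parts of `V_j` -/

section Vertex

variable [Fintype ι] [DecidableEq ι] {K : Type*} [Fintype K] (nbar : ℕ) (ε : ℝ) (c₀ : ι)

/-- *"bounded kernels … for V^{(n̄)}"*: `lowNormW ρ (V_j) ≤ Σ_k ‖c_k‖·L_k·L′_k` from the factor bounds `lowNormW ρ E_k ≤ L_k`,
`lowNormW ρ E′_k ≤ L′_k` (`ρ ≥ 0`). [cite: BalabanImbrieJaffe1988, (5.7.7) p.290] -/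
theorem lowNormW_vertexExp_le {ρ : ℝ} (hρ : 0 ≤ ρ) {c : K → ℂ} {E E' : K → GLExp ι} {L L' : K → ℝ}
    (hL : ∀ k, lowNormW ρ nbar (E k) ≤ L k) (hL' : ∀ k, lowNormW ρ nbar (E' k) ≤ L' k) :
    lowNormW ρ nbar (vertexExp nbar ε c₀ c E E') ≤ ∑ k, ‖c k‖ * (L k * L' k) := by
  refine (lowNormW_lsum_le nbar hρ _ c _).trans (Finset.sum_le_sum fun k _ => ?_)
  refine mul_le_mul_of_nonneg_left ((lowNormW_mul_le nbar hρ ε c₀ _ _).trans ?_) (norm_nonneg _)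
  exact mul_le_mul (hL k) (hL' k) (lowNormW_nonneg nbar hρ _) ((lowNormW_nonneg nbar hρ _).trans (hL k))

/-- *"small (O(e_j^{1−α})) … for V^{(n̄)}"*: when every first factor has positive order (`(E k).low 0 = 0`, the `F`'s start at
`n = 1`), `‖V_j^{(n̄)}‖ ≤ (|e_j|/ρ)·Σ_k ‖c_k‖L_kL′_k` (`0 < ρ`, `|e_j| ≤ ρ`).
[cite: BalabanImbrieJaffe1988, (5.6.11) p.287, (5.7.7) p.290] -/
theorem norm_vertexLow_le {ρ ε : ℝ} (hρ : 0 < ρ) (hερ : |ε| ≤ ρ) {c : K → ℂ} {E E' : K → GLExp ι}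
    (h0 : ∀ k, (E k).low 0 = 0) {L L' : K → ℝ} (hL : ∀ k, lowNormW ρ nbar (E k) ≤ L k)
    (hL' : ∀ k, lowNormW ρ nbar (E' k) ≤ L' k) :
    ‖vertexLow nbar ε c₀ c E E'‖ ≤ |ε| / ρ * ∑ k, ‖c k‖ * (L k * L' k) := by
  have hz : (vertexExp nbar ε c₀ c E E').low 0 = 0 := by
    show ∑ k, c k * (GLExp.mul nbar ε c₀ (E k) (E' k)).low 0 = 0
    exact Finset.sum_eq_zero fun k _ => by rw [GLExp.mul_low_zero nbar ε c₀ (h0 k), mul_zero]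
  exact (norm_lowVal_le_mul nbar hρ hερ hz).trans
    (mul_le_mul_of_nonneg_left (lowNormW_vertexExp_le nbar ε c₀ hρ.le hL hL') (div_nonneg (abs_nonneg _) hρ.le))

/-- **THE SIZE OF THE LOCALIZED PART OF `V_j`**: from the factor bounds `lowNormW ρ ≤ L`, `actNorm κ ≤ δ` (rooted factors,
`0 < ρ`, `|e_j| ≤ ρ`, `κ ≥ 0`): `actNorm κ (V_j) ≤ Σ_k ‖c_k‖((|e_j|/ρ)^{n̄+1}L_kL′_k + L_kδ′_k + δ_kL′_k + δ_kδ′_k)`.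
[cite: BalabanImbrieJaffe1988, (5.7.7) p.290] -/
theorem actNorm_vertexExp_le {ρ ε κ : ℝ} (hρ : 0 < ρ) (hερ : |ε| ≤ ρ) (hκ : 0 ≤ κ) {c : K → ℂ} {E E' : K → GLExp ι}
    (hE : ∀ k, Rooted c₀ (E k)) (hE' : ∀ k, Rooted c₀ (E' k)) {L L' δ δ' : K → ℝ}
    (hL : ∀ k, lowNormW ρ nbar (E k) ≤ L k) (hL' : ∀ k, lowNormW ρ nbar (E' k) ≤ L' k)
    (hδ : ∀ k, (E k).actNorm κ ≤ δ k) (hδ' : ∀ k, (E' k).actNorm κ ≤ δ' k) :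
    (vertexExp nbar ε c₀ c E E').actNorm κ ≤
      ∑ k, ‖c k‖ * ((|ε| / ρ) ^ (nbar + 1) * (L k * L' k) + L k * δ' k + δ k * L' k + δ k * δ' k) := by
  refine (actNorm_lsum_le κ _ c _).trans (Finset.sum_le_sum fun k _ => ?_)
  refine mul_le_mul_of_nonneg_left ((actNorm_mul_le nbar κ c₀ hρ hερ hκ (hE k) (hE' k)).trans ?_) (norm_nonneg _)
  have hL0 : 0 ≤ L k := (lowNormW_nonneg nbar hρ.le _).trans (hL k)
  have hδ0 : 0 ≤ δ k := (actNorm_nonneg κ _).trans (hδ k)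
  have h2 := lowNormW_nonneg nbar hρ.le (E' k)
  have h4 := actNorm_nonneg κ (E' k)
  have hA : lowNormW ρ nbar (E k) * lowNormW ρ nbar (E' k) ≤ L k * L' k := mul_le_mul (hL k) (hL' k) h2 hL0
  have hB : lowNormW ρ nbar (E k) * (E' k).actNorm κ ≤ L k * δ' k := mul_le_mul (hL k) (hδ' k) h4 hL0
  have hC : (E k).actNorm κ * lowNormW ρ nbar (E' k) ≤ δ k * L' k := mul_le_mul (hδ k) (hL' k) h2 hδ0
  have hD : (E k).actNorm κ * (E' k).actNorm κ ≤ δ k * δ' k := mul_le_mul (hδ k) (hδ' k) h4 hδ0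
  have hE1 : 0 ≤ (|ε| / ρ) ^ (nbar + 1) := pow_nonneg (div_nonneg (abs_nonneg _) hρ.le) _
  nlinarith [mul_le_mul_of_nonneg_left hA hE1]

/-- pointwise: `‖V_j(X)‖ ≤ actNorm κ (V_j)·e^{−κ|X|⁻}`. [cite: BalabanImbrieJaffe1988, (5.7.7) p.290] -/
theorem norm_vertexAct_le (κ : ℝ) (c : K → ℂ) (E E' : K → GLExp ι) (X : Finset ι) :
    ‖vertexAct nbar ε c₀ c E E' X‖ ≤
      (vertexExp nbar ε c₀ c E E').actNorm κ * Real.exp (-κ * (cubePolymers ι).cardMinus X) :=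
  norm_act_le_actNorm κ _ X

/-- **THE PRINTED SHAPE** *"of order e_j^{n̄+1−α}e^{−cr(e_k)|X|⁻} for V(X)"*: with uniform factor bounds `lowNormW ρ ≤ L`,
`actNorm κ ≤ δ` (`κ = cr(e_k)`; for `F_{1,j}` file 1a gives `δ` of order `e_j^{n̄+1−α}`), a weight `e_j ≤ ρ ≤ 1`, and the displayed
constants inequality `(Σ_k ‖c_k‖)((e_j/ρ)^{n̄+1}L² + 2Lδ + δ²) ≤ e_j^{n̄+1−α′}` (generic-constant reading): `‖V_j(X)‖ ≤
e_j^{n̄+1−α′}e^{−κ|X|⁻}`. [cite: BalabanImbrieJaffe1988, (5.7.7) p.290] -/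
theorem norm_vertexAct_le_printed {ρ ε κ L δ α' : ℝ} (hε0 : 0 < ε) (hερ : ε ≤ ρ) (hκ : 0 ≤ κ) {c : K → ℂ}
    {E E' : K → GLExp ι} (hE : ∀ k, Rooted c₀ (E k)) (hE' : ∀ k, Rooted c₀ (E' k))
    (hL : ∀ k, lowNormW ρ nbar (E k) ≤ L) (hL' : ∀ k, lowNormW ρ nbar (E' k) ≤ L) (hδ : ∀ k, (E k).actNorm κ ≤ δ)
    (hδ' : ∀ k, (E' k).actNorm κ ≤ δ)
    (hconst : (∑ k, ‖c k‖) * ((ε / ρ) ^ (nbar + 1) * L ^ 2 + 2 * L * δ + δ ^ 2) ≤ ε ^ ((nbar : ℝ) + 1 - α'))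
    (X : Finset ι) :
    ‖vertexAct nbar ε c₀ c E E' X‖ ≤ ε ^ ((nbar : ℝ) + 1 - α') * Real.exp (-κ * (cubePolymers ι).cardMinus X) := by
  have hεabs : |ε| ≤ ρ := by rw [abs_of_pos hε0]; exact hερ
  have hρ : 0 < ρ := hε0.trans_le hερ
  have hN := actNorm_vertexExp_le nbar c₀ hρ hεabs hκ (c := c) hE hE' (L := fun _ => L) (L' := fun _ => L)
    (δ := fun _ => δ) (δ' := fun _ => δ) hL hL' hδ hδ'
  rw [← Finset.sum_mul, abs_of_pos hε0] at hN
  refine (norm_vertexAct_le nbar ε c₀ κ c E E' X).trans (mul_le_mul_of_nonneg_right (hN.trans ?_) (Real.exp_pos _).le)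
  refine le_trans (le_of_eq ?_) hconst
  ring

end Vertex

end Literature.MathematicalPhysics.QuantumFieldTheory.BalabanImbrieJaffe1984to88.BIJ88Expansion577Bounds

end
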